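import Literature.NumberTheory.Automorphic.MeanSquareLowerGL2
import Literature.NumberTheory.Automorphic.MeanSquareSchurGL2
import Literature.NumberTheory.Automorphic.JacquetShalikaSchurSelfSum
import Literature.NumberTheory.Automorphic.GLnCuspidalSpectrumSiegel
import Literature.NumberTheory.Automorphic.AdicCompletionResidueCard
import Literature.NumberTheory.Automorphic.AdeleAddCharUnramified
import Literature.NumberTheory.Automorphic.AutomorphicTwistSatake
import Literature.NumberTheory.Automorphic.LocalComponentGeneric
import HarnessLib

/-!
# The standard Euler product of a cuspidal representation of `GL₂` converges for `re s > 1`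

Topic `NumberTheory/Automorphic`; namespace `Literature.NumberTheory.Automorphic`. This file closes
the mean-square route to **Jacquet–Shalika (1981), Theorem (5.3), for `GL₂`**: for every cuspidal
automorphic representation `Π` of `GL₂(𝔸_K)` (`CuspidalAutomorphicRepGL 2 K μ`, an irreducible
closed invariant subspace of `L²_cusp`) and every datum `D : StandardLFunctionData Π`, the Euler
product `∏_v P_v(q_v^{-s})⁻¹` is `Multipliable` for `re s > 1`
(`StandardLFunctionData.multipliable_L_two`). By `JacquetShalikaSchurSelfSum`
(`multipliable_L_of_schurSelfSum_prod_bounded`) it suffices to prove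
`JacquetShalika1981_schurSelfSum_prod_bounded` for `n = 2`
(`jacquetShalika1981_schurSelfSum_prod_bounded_two`), i.e. a uniform bound for the finite products
of the Schur self sums `∑_λ |s_λ(x_v)|² q_v^{-|λ|σ}` of the Satake parameters off a finite set.

The proof (no Eisenstein series, no multiplicity one, no Ramanujan-type input):
1. If `Π` has no non-zero `K(𝔫)`-fixed vector for any `𝔫 ≠ 0`, `IsSatakeFamilyOf Π S α` forces every
   place into `S` and the statement is trivial. Otherwise smooth a non-zero `K(𝔫₀)`-fixed `f₀` to
   the continuous `S_η f₀ ≠ 0` (`exists_weight_smoothedVector_ne_zero`,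
   `smoothedForm_ne_zero_of_smoothedVector_ne_zero` of `LocalComponentGeneric`) and put
   `φ = invQuot (S_η f₀)`, `W = W_φ` its Whittaker coefficient for Tate's character and Tate's box
   (a Haar measure on `N₂(𝔸_K)`); `W` is continuous and generic (`CuspidalWhittakerGL2`), and by the
   Iwasawa decomposition and `N`-equivariance `W(d(y₀, a₀) k₀) ≠ 0` for some ideles `y₀, a₀` and
   `k₀ ∈ K`.
2. `S₀ = supp 𝔫₀ ∪ S_ψ ∪ {v : |y₀,ᵥ| ≠ 1} ∪ {v : |a₀,ᵥ| ≠ 1}` (`AdeleAddCharUnramified`,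
   `finite_setOf_valued_snd_ne_one`). For `S ⊇ S₀` and a Satake family `α` off `S` enumerated by
   `x`, Shintani's formula (`exists_uniformizer_whittakerCoeff_smoothedForm_piPowGL_eq`,
   `WhittakerFactorizationGL2`) gives uniformizers `ϖ_v` and the relations
   `W(ι_v(d(ϖ_v^m,1)) g') = q_v^{-m/2} s_m(x_v) W(g')` at every `v ∉ S`, and `W` is right
   `ι_v(GL₂(𝒪_v))`-invariant there (`invQuot_smoothedForm_mul_ofLocal`).
3. The mean-square bounds (`exists_meanSquare_lower_bound_of_valued_eq_one`,
   `exists_meanSquare_upper_bound`) squeeze `I₀ ∑_{m} N(m)⁻¹|λ(m)|² ≤ C ‖S_η f₀‖₂²` for the profiles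
   `m` in a dyadic window, uniformly; specialised to single-place profiles this is
   `DyadicBound x Good B` (`MeanSquareSchurGL2`).
4. `|x_{v,0} x_{v,1}| = 1` (`norm_mul_eq_one_of_isSatakeFamilyOf`: the Hecke operator of the central
   `t_{v,2}` is the isometry `R(t_{v,2})`), and `schurSelfSum_prod_le_of_dyadicBound` concludes.

## References

* H. Jacquet, J. A. Shalika, *On Euler products and the classification of automorphic
  representations I*, Amer. J. Math. 103 (1981), Thm. (5.3) [JacquetShalikaAJM1981].
-/

noncomputable section

open MeasureTheory Measure NumberField IsDedekindDomain Matrix Set Filter Topology Finset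
open scoped MatrixGroups ENNReal NNReal Pointwise ComplexConjugate
open Literature.RingTheory.SymmetricFunctions.SymmPoly

namespace Literature.NumberTheory.Automorphic

section Prelim

variable {K : Type} [Field K] [NumberField K]

/-- **Unitarity of the central character at the good places**: if `α v` is a Satake parameter of
the cuspidal `Π` of `GL₂` at `v` and `x` enumerates it, then `|x₀ x₁| = 1` (the Hecke operator of
the central `t_{v,2} = ϖ 1₂` is the isometry `R(t_{v,2})`, with eigenvalue `e₂(α v) = x₀ x₁`).
[folklore] -/
theorem norm_mul_eq_one_of_isSatakeFamilyOf {μ : Measure (AdelicGroupData.gl 2 K).automorphicQuotient}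
    [(AdelicGroupData.gl 2 K).IsAutomorphicMeasure μ] (P : CuspidalAutomorphicRepGL 2 K μ)
    {S : Set (HeightOneSpectrum (𝓞 K))} {α : SatakeFamily K} (hα : IsSatakeFamilyOf P S α)
    {v : HeightOneSpectrum (𝓞 K)} (hv : v ∉ S) {x : Fin 2 → ℂ} (hx : (univ : Finset (Fin 2)).val.map x = α v) :
    ‖x 0 * x 1‖ = 1 := by
  obtain ⟨𝔫, -, -, ϖ, hsat⟩ := hα v hv
  obtain ⟨-, -, f, hfK, hf0, heig⟩ := hsat
  have key := heig 2 le_rfl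
  have e : heckeOperatorAt P.1 (principalCongruenceLevel 2 K 𝔫) (heckeDiagAt 2 K v ϖ 2) f =
      P.1.toContRep (heckeDiagAt 2 K v ϖ 2) f :=
    heckeOperator_apply_of_mem_center _ _ (heckeDiagAt_self_mem_center v ϖ) hfK
  have hes : (α v).esymm 2 = x 0 * x 1 := by
    have hpc : Finset.powersetCard 2 (Finset.univ : Finset (Fin 2)) = {Finset.univ} := by
      simpa using Finset.powersetCard_self (Finset.univ : Finset (Fin 2))
    rw [← hx, Finset.esymm_map_val, hpc, Finset.sum_singleton, Fin.prod_univ_two]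
  rw [e, hes] at key
  simp only [Nat.sub_self, mul_zero, pow_zero, one_mul] at key
  have h1 : ‖x 0 * x 1‖ * ‖f‖ = ‖f‖ := by
    rw [← norm_smul, ← key, norm_toContRep_apply]
  exact (mul_eq_right₀ (norm_ne_zero_iff.mpr hf0)).mp h1

/-- An idele has components of valuation `1` at all but finitely many places. [folklore] -/
theorem finite_setOf_valued_snd_ne_one (y : (AdeleRing (𝓞 K) K)ˣ) :
    {v : HeightOneSpectrum (𝓞 K) | Valued.v (((y : AdeleRing (𝓞 K) K)).2 v) ≠ 1}.Finite := by
  refine (hasFiniteMulSupport_nnnorm K y).subset fun v hv => ?_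
  rw [Function.mem_mulSupport]
  intro h1
  apply hv
  have h := NumberField.FinitePlace.norm_def (K := K) (v := v) (((y : AdeleRing (𝓞 K) K)).2 v)
  rw [← coe_nnnorm, h1, NNReal.coe_one] at h
  have h' : WithZeroMulInt.toNNReal (NumberField.HeightOneSpectrum.absNorm_ne_zero v) (Valued.v (((y : AdeleRing (𝓞 K) K)).2 v)) = 1 := by
    exact_mod_cast h.symm
  exact (WithZeroMulInt.toNNReal_eq_one_iff _ (NumberField.HeightOneSpectrum.absNorm_ne_zero v)
    (NumberField.HeightOneSpectrum.one_lt_absNorm_nnreal v).ne').1 h'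

end Prelim

section Main

variable (K : Type) [Field K] [NumberField K]

attribute [local instance] adelicBorel borelSpace_adelic glTwoBorel borelSpace_glTwo

variable {K}
variable {μ : Measure (AdelicGroupData.gl 2 K).automorphicQuotient} [(AdelicGroupData.gl 2 K).IsAutomorphicMeasure μ]

/-- The smoothed form of an `L²` class is square integrable. [folklore] -/
theorem lintegral_enorm_sq_smoothedForm_ne_top
    (W : ContRepresentation.ClosedSubrep ((AdelicGroupData.gl 2 K).rightRegular μ))
    {η : (AdelicGroupData.gl 2 K).Adelic → ℝ} (hη : Continuous η) (hηs : HasCompactSupport η)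
    (f : W.toSubmodule) :
    ∫⁻ x, ‖smoothedForm η (f : (AdelicGroupData.gl 2 K).L2 μ) x‖ₑ ^ 2 ∂μ ≠ ⊤ := by
  have hae := smoothedVector_ae_eq W hη hηs f
  have hmem : MemLp (smoothedForm η (f : (AdelicGroupData.gl 2 K).L2 μ)) 2 μ :=
    (Lp.memLp _).ae_eq hae
  have h2 := hmem.eLpNorm_lt_top
  rw [eLpNorm_eq_lintegral_rpow_enorm_toReal two_ne_zero ENNReal.ofNat_ne_top] at h2
  have h3 : ∫⁻ x, ‖smoothedForm η (f : (AdelicGroupData.gl 2 K).L2 μ) x‖ₑ ^ ((2 : ℝ≥0∞).toReal) ∂μ < ⊤ := by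
    by_contra htop
    rw [not_lt, top_le_iff] at htop
    rw [htop, ENNReal.top_rpow_of_pos (by norm_num)] at h2
    exact lt_irrefl _ h2
  have h4 : ∀ x, ‖smoothedForm η (f : (AdelicGroupData.gl 2 K).L2 μ) x‖ₑ ^ ((2 : ℝ≥0∞).toReal) =
      ‖smoothedForm η (f : (AdelicGroupData.gl 2 K).L2 μ) x‖ₑ ^ 2 := by
    intro x
    rw [ENNReal.toReal_ofNat, ENNReal.rpow_two]
  simp_rw [h4] at h3
  exact h3.ne

/-- **Jacquet–Shalika's bound on the unramified Rankin–Selberg torus sums at real points, for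
`GL₂`, by the mean-square method** (`JacquetShalika1981_schurSelfSum_prod_bounded` for `n = 2`).
For a cuspidal `Π` of `GL₂(𝔸_K)` with a non-zero `K(𝔫₀)`-fixed vector `f₀` (else the statement is
vacuous), smooth it to `φ = invQuot (S_η f₀) ≠ 0` (`exists_weight_smoothedVector_ne_zero`); its
Whittaker coefficient `W_φ` is continuous, generic (`CuspidalWhittakerGL2`), satisfies Shintani's
relations off `S ⊇ S₀ = supp 𝔫₀ ∪ S_ψ ∪` (bad places of the base point)
(`WhittakerFactorizationGL2`), and the mean-square bounds (`MeanSquareUpperGL2`,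
`MeanSquareLowerGL2`) give the dyadic hypothesis for the single-place profiles; the unitarity
`|x₀ x₁| = 1` of the central character and `MeanSquareSchurGL2` conclude.
[cite: JacquetShalikaAJM1981, Thm. (5.3), (5.3.3)–(5.3.4)] -/
theorem jacquetShalika1981_schurSelfSum_prod_bounded_two :
    JacquetShalika1981_schurSelfSum_prod_bounded (n := 2) (K := K) (μ := μ) := by
  intro P
  classical
  by_cases hP : ∃ 𝔫₀ : Ideal (𝓞 K), 𝔫₀ ≠ 0 ∧ ∃ f ∈ P.1.fixedVectors (principalCongruenceLevel 2 K 𝔫₀), f ≠ 0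
  swap
  · refine ⟨∅, fun S α _ hα x hx σ hσ => ⟨1, ENNReal.one_ne_top, fun F => ?_⟩⟩
    have hempty : IsEmpty {v : HeightOneSpectrum (𝓞 K) // v ∉ (↑S : Set (HeightOneSpectrum (𝓞 K)))} := by
      refine ⟨fun v => ?_⟩
      obtain ⟨𝔫, h𝔫, -, ϖ, hsat⟩ := hα v.1 v.2
      obtain ⟨-, -, f, hfK, hf0, -⟩ := hsat
      exact hP ⟨𝔫, h𝔫, f, hfK, hf0⟩
    rw [Finset.eq_empty_of_isEmpty F, Finset.prod_empty]
  obtain ⟨𝔫₀, h𝔫₀, f₀, hf₀K, hf₀0⟩ := hP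
  -- smoothing
  obtain ⟨η, hη, hηs, -, hηK, hne⟩ := exists_weight_smoothedVector_ne_zero (W := P.1)
    (isCompact_principalCongruenceLevel 2 K h𝔫₀) hf₀K hf₀0
  have hFc : Continuous (smoothedForm η (f₀ : (AdelicGroupData.gl 2 K).L2 μ)) := continuous_smoothedForm hη hηs _
  have hFne : smoothedForm η (f₀ : (AdelicGroupData.gl 2 K).L2 μ) ≠ 0 :=
    smoothedForm_ne_zero_of_smoothedVector_ne_zero hη hηs hne
  have hcusp : ((f₀ : P.1.toSubmodule) : (AdelicGroupData.gl 2 K).L2 μ) ∈ cuspidalSubspace 2 K μ :=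
    P.le_cuspidalSubspace f₀.2
  have hL2 := lintegral_enorm_sq_smoothedForm_ne_top P.1 hη hηs f₀
  -- measurable structures and measures
  letI : MeasurableSpace (AdeleRing (𝓞 K) K) := borel _
  haveI : BorelSpace (AdeleRing (𝓞 K) K) := ⟨rfl⟩
  letI : MeasurableSpace (AdeleRing (𝓞 K) K)ˣ := borel _
  haveI : BorelSpace (AdeleRing (𝓞 K) K)ˣ := ⟨rfl⟩
  letI : MeasurableSpace (adeleQuotient K) := borel _
  haveI : BorelSpace (adeleQuotient K) := ⟨rfl⟩
  haveI : T2Space (AdeleRing (𝓞 K) K) := t2Space_adeleRing K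
  haveI := locallyCompactSpace_adeleRing' K
  haveI := locallyCompactSpace_ideleGroup K
  haveI := secondCountableTopology_ideleGroup K
  haveI := t2Space_ideleGroup K
  obtain ⟨hT2G, hLCG, hSCG⟩ := topology_gl2_adele K
  haveI : CompactSpace ↥(standardMaximalCompactGL 2 K) :=
    isCompact_iff_compactSpace.1 (isCompact_standardMaximalCompactGL 2 K)
  set ν : Measure ↥(adelicUnipotent 2 K) := Measure.haar with hν
  haveI hνR : ν.IsMulRightInvariant := isMulRightInvariant_of_isHaarMeasure_adelicUnipotent ν
  set μI : Measure (AdeleRing (𝓞 K) K)ˣ := Measure.haar with hμI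
  set μK : Measure ↥(standardMaximalCompactGL 2 K) := Measure.haar with hμK
  have hψ : IsGlobalAddChar K (adeleAddChar K) := isGlobalAddChar_adeleAddChar (K := K)
  have h𝓕 : IsFundamentalDomain ↥(rationalUnipotent 2 K) (unipotentTateDomain 2 K) ν :=
    isFundamentalDomain_unipotentTateDomain ν
  have h𝓕c : IsCompact (closure (unipotentTateDomain 2 K)) := isCompact_closure_unipotentTateDomain
  have h𝓕m : MeasurableSet (unipotentTateDomain 2 K) := measurableSet_unipotentTateDomain
  set φ : GL (Fin 2) (AdeleRing (𝓞 K) K) → ℂ :=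
    invQuot (AdelicGroupData.gl 2 K) (smoothedForm η (f₀ : (AdelicGroupData.gl 2 K).L2 μ)) with hφ
  have hφc : Continuous φ := hFc.comp ((AdelicGroupData.gl 2 K).continuous_toAutomorphicQuotient.comp
    (continuous_inv : Continuous fun g : (AdelicGroupData.gl 2 K).Adelic => g⁻¹))
  set W : GL (Fin 2) (AdeleRing (𝓞 K) K) → ℂ := whittakerCoeff ν (unipotentTateDomain 2 K) (adeleAddChar K) φ with hW
  have hWc : Continuous W := continuous_whittakerCoeff h𝓕m h𝓕c hψ.continuous hφc
  -- genericity and the base point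
  obtain ⟨g₁, hg₁⟩ := exists_whittakerCoeff_invQuot_smoothedForm_ne_zero hη hηs hcusp hFne ν
  obtain ⟨b, hb, k₀, hk₀, hg₁eq⟩ := exists_borel_mul_maximalCompact_eq (K := K) g₁
  set ya : (AdeleRing (𝓞 K) K)ˣ × (AdeleRing (𝓞 K) K)ˣ := borelDiagGL2 ⟨b, hb⟩ with hya
  set ub : ↥(upperUnitriangular (Fin 2) (AdeleRing (𝓞 K) K)) := borelUnipGL2 ⟨b, hb⟩ with hub
  set u' : ↥(upperUnitriangular (Fin 2) (AdeleRing (𝓞 K) K)) := torusConjGL2 ya⁻¹ ub with hu'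
  have hbdec : b = ((u' : ↥(adelicUnipotent 2 K)) : GL (Fin 2) (AdeleRing (𝓞 K) K)) * diagGL2 ya.1 ya.2 := by
    have h1 := diagGL2_mul_borelUnipGL2 (⟨b, hb⟩ : ↥(standardParabolicGL (AdeleRing (𝓞 K) K) (id : Fin 2 → Fin 2)))
    have h2 := diagGL2_mul_torusConjGL2 ya u'
    have h3 : torusConjGL2 ya u' = ub := by
      rw [hu']
      have := torusConjGL2_inv_apply ya⁻¹ ub
      rwa [inv_inv] at this
    rw [h3] at h2
    change diagGL2 ya.1 ya.2 * (ub : GL (Fin 2) (AdeleRing (𝓞 K) K)) = b at h1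
    rw [← h1, h2]
  have hW0 : W (diagGL2 ya.1 ya.2 * k₀) ≠ 0 := by
    intro h0
    apply hg₁
    have h := whittakerCoeff_unipotent_mul (ν := ν) (𝓕 := unipotentTateDomain 2 K) (ψ := adeleAddChar K)
      h𝓕 hψ (isLeftInvariant_invQuot (AdelicGroupData.gl 2 K) (smoothedForm η (f₀ : (AdelicGroupData.gl 2 K).L2 μ)))
      u' (diagGL2 ya.1 ya.2 * k₀)
    change W ((u' : GL (Fin 2) (AdeleRing (𝓞 K) K)) * (diagGL2 ya.1 ya.2 * k₀)) = _ * W (diagGL2 ya.1 ya.2 * k₀) at h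
    rw [hg₁eq, hbdec, mul_assoc]
    change W ((u' : GL (Fin 2) (AdeleRing (𝓞 K) K)) * (diagGL2 ya.1 ya.2 * k₀)) = 0
    rw [h, h0, mul_zero]
  -- the exceptional set
  obtain ⟨Sψ, hSψ⟩ := exists_finset_adicComponent_adeleAddChar_unramified (K := K)
  set S₀ : Finset (HeightOneSpectrum (𝓞 K)) := (Ideal.finite_factors h𝔫₀).toFinset ∪ Sψ ∪
    (finite_setOf_valued_snd_ne_one ya.1).toFinset ∪ (finite_setOf_valued_snd_ne_one ya.2).toFinset with hS₀
  refine ⟨S₀, fun S α hS hα x hx σ hσ => ?_⟩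
  -- facts at the good places
  have hgood : ∀ v : HeightOneSpectrum (𝓞 K), v ∉ (↑S : Set (HeightOneSpectrum (𝓞 K))) →
      ¬ v.asIdeal ∣ 𝔫₀ ∧ v ∉ Sψ ∧ Valued.v ((((ya.1 : (AdeleRing (𝓞 K) K)ˣ)) : AdeleRing (𝓞 K) K).2 v) = 1 ∧
        Valued.v ((((ya.2 : (AdeleRing (𝓞 K) K)ˣ)) : AdeleRing (𝓞 K) K).2 v) = 1 := by
    intro v hv
    have hv0 : v ∉ S₀ := fun h => hv (hS h)
    simp only [hS₀, Finset.mem_union, Set.Finite.mem_toFinset, Set.mem_setOf_eq, not_or] at hv0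
    obtain ⟨⟨⟨h1, h2⟩, h3⟩, h4⟩ := hv0
    exact ⟨h1, h2, not_not.1 h3, not_not.1 h4⟩
  -- Shintani data at the good places
  have hdata : ∀ v : {v : HeightOneSpectrum (𝓞 K) // v ∉ (↑S : Set (HeightOneSpectrum (𝓞 K)))},
      ∃ ϖ : (v.1.adicCompletion K)ˣ, Valued.v (ϖ : v.1.adicCompletion K) = WithZero.exp (-1 : ℤ) ∧
        ∀ g' : GL (Fin 2) (AdeleRing (𝓞 K) K), Matrix.GeneralLinearGroup.map (AdelicGroupData.adeleEval K v.1) g' = 1 →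
          ∀ m : ℕ, W (GLn.ofLocal 2 K v.1 (diagGL2 (ϖ ^ m) 1) * g') =
            ((((Real.sqrt (v.1.residueCard : ℝ) : ℝ) : ℂ)) ^ (-(m : ℤ)) * schur (x v) ![m, 0]) * W g' := by
    intro v
    obtain ⟨hv𝔫, hvψ, -, -⟩ := hgood v.1 v.2
    obtain ⟨hψv, hψv'⟩ := hSψ v.1 hvψ
    obtain ⟨ϖ, hϖ, hT⟩ := exists_uniformizer_whittakerCoeff_smoothedForm_piPowGL_eq (ν := ν)
      (𝓕 := unipotentTateDomain 2 K) (ψ := adeleAddChar K) P hα h𝔫₀ v.2 hv𝔫 hη hηs hηK f₀ (hx v) h𝓕 h𝓕c hψ hψv hψv'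
      (natCard_valuativeResidueField_adicCompletion_eq K v.1)
    refine ⟨ϖ, hϖ, fun g' hg' m => ?_⟩
    have h := (hT hg').1 (antitone_vecCons_zero m)
    rw [torusExponent_vecCons_zero] at h
    have hpi : piPowGL (isUniformizingElement_of_valued_eq K v.1 hϖ).ne_zero ![m, 0] = diagGL2 (ϖ ^ m) 1 :=
      piPowGL_vecCons ϖ m
    rw [hpi] at h
    exact h
  choose ϖS hϖS hShS using hdata
  -- extension of the data to all places
  set Good : Set (HeightOneSpectrum (𝓞 K)) := {v | v ∉ (↑S : Set (HeightOneSpectrum (𝓞 K)))} with hGood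
  set ϖ : (v : HeightOneSpectrum (𝓞 K)) → (v.adicCompletion K)ˣ := fun v =>
    if h : v ∉ (↑S : Set (HeightOneSpectrum (𝓞 K))) then ϖS ⟨v, h⟩ else 1 with hϖdef
  set x' : HeightOneSpectrum (𝓞 K) → Fin 2 → ℂ := fun v =>
    if h : v ∉ (↑S : Set (HeightOneSpectrum (𝓞 K))) then x ⟨v, h⟩ else 0 with hx'def
  set c : HeightOneSpectrum (𝓞 K) → ℕ → ℂ := fun v m =>
    (((Real.sqrt (v.residueCard : ℝ) : ℝ) : ℂ)) ^ (-(m : ℤ)) * schur (x' v) ![m, 0] with hcdef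
  have hϖ : ∀ v ∈ Good, Valued.v (ϖ v : v.adicCompletion K) = WithZero.exp (-1 : ℤ) := by
    intro v hv
    have hv' : v ∉ (↑S : Set (HeightOneSpectrum (𝓞 K))) := hv
    simp only [hϖdef, dif_pos hv']
    exact hϖS ⟨v, hv'⟩
  have hx' : ∀ (v : HeightOneSpectrum (𝓞 K)) (hv : v ∉ (↑S : Set (HeightOneSpectrum (𝓞 K)))), x' v = x ⟨v, hv⟩ := by
    intro v hv
    simp only [hx'def, dif_pos hv]
  have hSh : ∀ v ∈ Good, ∀ g' : GL (Fin 2) (AdeleRing (𝓞 K) K),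
      Matrix.GeneralLinearGroup.map (AdelicGroupData.adeleEval K v) g' = 1 →
        ∀ m : ℕ, W (GLn.ofLocal 2 K v (diagGL2 (ϖ v ^ m) 1) * g') = c v m * W g' := by
    intro v hv g' hg' m
    have hv' : v ∉ (↑S : Set (HeightOneSpectrum (𝓞 K))) := hv
    have h := hShS ⟨v, hv'⟩ g' hg' m
    simp only [hcdef, hϖdef, dif_pos hv', hx' v hv']
    exact h
  have hInv : ∀ v ∈ Good, ∀ k ∈ glInt 2 (v.adicCompletion K), ∀ y : GL (Fin 2) (AdeleRing (𝓞 K) K),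
      W (y * GLn.ofLocal 2 K v k) = W y := by
    intro v hv k hk y
    obtain ⟨hv𝔫, -, -, -⟩ := hgood v hv
    exact whittakerCoeff_mul_of_forall (ν := ν) (𝓕 := unipotentTateDomain 2 K) (ψ := adeleAddChar K)
      (fun z => invQuot_smoothedForm_mul_ofLocal h𝔫₀ hv𝔫 hηK _ hk z) y
  have hy₀ : ∀ v ∈ Good, Valued.v ((((ya.1 : (AdeleRing (𝓞 K) K)ˣ)) : AdeleRing (𝓞 K) K).2 v) = 1 :=
    fun v hv => (hgood v hv).2.2.1
  have ha₀ : ∀ v ∈ Good, Valued.v ((((ya.2 : (AdeleRing (𝓞 K) K)ˣ)) : AdeleRing (𝓞 K) K).2 v) = 1 :=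
    fun v hv => (hgood v hv).2.2.2
  -- the mean-square bounds
  obtain ⟨C₂, hC₂c, Kc, I₀, hI₀, hlow⟩ := exists_meanSquare_lower_bound_of_valued_eq_one μI μK hWc ϖ hϖ c hSh hInv
    hy₀ ha₀ hk₀ hW0
  have hY₁ : IsCompact (ya.1 • (posRealIdeleSegment K * normOneIdeleCover K)) :=
    ((isCompact_posRealIdeleSegment K).mul (isCompact_normOneIdeleCover K)).smul ya.1
  obtain ⟨Cup, hCuptop, hup⟩ := exists_meanSquare_upper_bound (μ := μ) ν μI μK hY₁ hC₂c Kc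
  set B : ℝ≥0∞ := Cup * (∫⁻ q, ‖smoothedForm η (f₀ : (AdelicGroupData.gl 2 K).L2 μ) q‖ₑ ^ 2 ∂μ) / I₀ with hBdef
  have hBtop : B ≠ ⊤ := ENNReal.div_ne_top (ENNReal.mul_ne_top hCuptop hL2) hI₀
  have hprof : ∀ r : ℝ≥0ˣ, (r : ℝ≥0) ≤ 1 → ∀ Ms : Finset (HeightOneSpectrum (𝓞 K) →₀ ℕ),
      (∀ m ∈ Ms, ↑m.support ⊆ Good ∧
        1 / 2 ≤ (profileNorm m : ℝ) * ((r : ℝ≥0) : ℝ) ^ Module.finrank ℚ K ∧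
        (profileNorm m : ℝ) * ((r : ℝ≥0) : ℝ) ^ Module.finrank ℚ K ≤ 1) →
      ∑ m ∈ Ms, ‖∏ v ∈ m.support, c v (m v)‖ₑ ^ 2 ≤ B := by
    intro r hr Ms hMs
    have h1 := hlow r Ms hMs
    have h2 := hup hFc r hr
    rw [hBdef, ENNReal.le_div_iff_mul_le (Or.inl hI₀) (Or.inr (ENNReal.mul_ne_top hCuptop hL2)), mul_comm]
    exact h1.trans h2
  -- the norm of the Shintani constants
  have hcnorm : ∀ (v : HeightOneSpectrum (𝓞 K)) (k : ℕ),
      ‖c v k‖ₑ ^ 2 = ENNReal.ofReal (((v.residueCard : ℝ) ^ k)⁻¹ * ‖schur (x' v) ![k, 0]‖ ^ 2) := by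
    intro v k
    have hq : (0 : ℝ) < v.residueCard := by exact_mod_cast zero_lt_one.trans v.one_lt_residueCard
    have hs : (0 : ℝ) < Real.sqrt (v.residueCard : ℝ) := Real.sqrt_pos.2 hq
    rw [← ofReal_norm, ← ENNReal.ofReal_pow (norm_nonneg _)]
    congr 1
    rw [hcdef]
    simp only
    rw [norm_mul, norm_zpow, Complex.norm_real, Real.norm_of_nonneg hs.le, mul_pow, _root_.zpow_neg, zpow_natCast, inv_pow,
      ← pow_mul, mul_comm k 2, pow_mul, Real.sq_sqrt hq.le]
  -- the dyadic hypothesis for the extended family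
  have hDY : DyadicBound x' Good B := by
    intro X hX T hT
    -- the dilation parameter `r` with `r^d = X⁻¹`
    have hXpos : 0 < X := zero_lt_one.trans_le hX
    have hd : 0 < Module.finrank ℚ K := Module.finrank_pos
    set rr : ℝ := X ^ (-(1 / (Module.finrank ℚ K : ℝ))) with hrr
    have hrrpos : 0 < rr := Real.rpow_pos_of_pos hXpos _
    have hrrle : rr ≤ 1 := Real.rpow_le_one_of_one_le_of_nonpos hX (by
      have : (0 : ℝ) < Module.finrank ℚ K := by exact_mod_cast hd
      have := div_pos one_pos this
      linarith)
    have hrrd : rr ^ Module.finrank ℚ K = X⁻¹ := by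
      rw [hrr, ← Real.rpow_natCast, ← Real.rpow_mul hXpos.le, neg_mul,
        div_mul_cancel₀ _ (by exact_mod_cast hd.ne' : (Module.finrank ℚ K : ℝ) ≠ 0), Real.rpow_neg_one]
    set r : ℝ≥0ˣ := Units.mk0 ⟨rr, hrrpos.le⟩ (by
      rw [Ne, ← NNReal.coe_eq_zero]; exact hrrpos.ne') with hr
    have hrval : ((r : ℝ≥0) : ℝ) = rr := rfl
    have hr1 : (r : ℝ≥0) ≤ 1 := by
      rw [← NNReal.coe_le_coe, hrval]; exact hrrle
    -- the single-place profiles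
    set sing : HeightOneSpectrum (𝓞 K) × ℕ → (HeightOneSpectrum (𝓞 K) →₀ ℕ) := fun p => Finsupp.single p.1 p.2 with hsing
    have hinj : Set.InjOn sing ↑T := by
      intro p hp p' hp' hpp
      have hk : 1 ≤ p.2 := (hT p hp).2.1
      have hk' : 1 ≤ p'.2 := (hT p' hp').2.1
      simp only [hsing] at hpp
      rcases (Finsupp.single_eq_single_iff _ _ _ _).1 hpp with ⟨h1, h2⟩ | ⟨h1, -⟩
      · exact Prod.ext h1 h2
      · omega
    have hsupp : ∀ p ∈ T, (sing p).support = {p.1} := fun p hp =>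
      Finsupp.support_single _ (by have := (hT p hp).2.1; omega)
    have hnorm : ∀ p ∈ T, profileNorm (sing p) = p.1.residueCard ^ p.2 := by
      intro p hp
      rw [profileNorm, hsupp p hp, Finset.prod_singleton]
      simp [hsing]
    have hwin : ∀ m ∈ T.image sing, ↑m.support ⊆ Good ∧
        1 / 2 ≤ (profileNorm m : ℝ) * ((r : ℝ≥0) : ℝ) ^ Module.finrank ℚ K ∧
        (profileNorm m : ℝ) * ((r : ℝ≥0) : ℝ) ^ Module.finrank ℚ K ≤ 1 := by
      intro m hm
      obtain ⟨p, hp, rfl⟩ := Finset.mem_image.1 hm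
      obtain ⟨hG, hk, hlo, hhi⟩ := hT p hp
      rw [hsupp p hp, Finset.coe_singleton, Set.singleton_subset_iff, hnorm p hp, hrval, hrrd, Nat.cast_pow]
      refine ⟨hG, ?_, ?_⟩
      · rw [div_le_iff₀ (by norm_num : (0:ℝ) < 2)] at hlo
        rw [le_mul_inv_iff₀ hXpos]
        linarith
      · rw [mul_inv_le_iff₀ hXpos]
        linarith
    have h := hprof r hr1 (T.image sing) hwin
    rw [Finset.sum_image hinj] at h
    refine le_trans (le_of_eq ?_) h
    refine Finset.sum_congr rfl fun p hp => ?_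
    rw [hsupp p hp, Finset.prod_singleton]
    simp only [hsing, Finsupp.single_eq_same]
    exact (hcnorm p.1 p.2).symm
  -- unitarity of the central character on `Good`
  have hx1 : ∀ v ∈ Good, ‖x' v 0 * x' v 1‖ = 1 := by
    intro v hv
    have hv' : v ∉ (↑S : Set (HeightOneSpectrum (𝓞 K))) := hv
    rw [hx' v hv']
    exact norm_mul_eq_one_of_isSatakeFamilyOf P hα hv' (hx ⟨v, hv'⟩)
  obtain ⟨C, hC, hprod⟩ := schurSelfSum_prod_le_of_dyadicBound hx1 hBtop hDY hσ
  refine ⟨C, hC, fun F => ?_⟩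
  have hsub : (↑(F.map (Function.Embedding.subtype _)) : Set (HeightOneSpectrum (𝓞 K))) ⊆ Good := by
    intro v hv
    rw [Finset.coe_map, Set.mem_image] at hv
    obtain ⟨w, -, rfl⟩ := hv
    exact w.2
  have h := hprod (F.map (Function.Embedding.subtype _)) hsub
  rw [Finset.prod_map] at h
  refine le_trans (le_of_eq (Finset.prod_congr rfl fun v _ => ?_)) h
  rw [Function.Embedding.coe_subtype, hx' v.1 v.2]

/-- **The standard Euler product of a cuspidal automorphic representation of `GL₂(𝔸_K)` converges
absolutely for `re s > 1`** — Jacquet–Shalika (1981), Theorem (5.3), for `n = 2`: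
`StandardLFunctionData.multipliable_L` holds for every cuspidal `Π` of `GL₂` and every datum `D`
(`multipliable_L_of_schurSelfSum_prod_bounded` of `JacquetShalikaSchurSelfSum` with
`jacquetShalika1981_schurSelfSum_prod_bounded_two`). [cite: JacquetShalikaAJM1981, Thm. (5.3)] -/
theorem StandardLFunctionData.multipliable_L_two {P : CuspidalAutomorphicRepGL 2 K μ} :
    StandardLFunctionData.multipliable_L (P := P) :=
  StandardLFunctionData.multipliable_L_of_schurSelfSum_prod_bounded jacquetShalika1981_schurSelfSum_prod_bounded_two

/-- The partial standard `L`-series `L^S(s, Π)` of a cuspidal `Π` of `GL₂(𝔸_K)` converges absolutely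
for `re s > 1` (the named fact `absolutelyConvergent_partialStandardL` for `n = 2`; Jacquet–Shalika
(1981), Thm. (5.3) with Remark (5.4)). [cite: JacquetShalikaAJM1981, Thm. (5.3), Remark (5.4)] -/
theorem absolutelyConvergent_partialStandardL_two : absolutelyConvergent_partialStandardL (n := 2) (K := K) (μ := μ) :=
  absolutelyConvergent_partialStandardL_of_schurSelfSum_prod_bounded jacquetShalika1981_schurSelfSum_prod_bounded_two

/-- The partial standard Euler product of a cuspidal `Π` of `GL₂(𝔸_K)` is multipliable for
`re s > 1` (`multipliable_partialStandardL` for `n = 2`). [cite: JacquetShalikaAJM1981, Thm. (5.3)] -/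
theorem multipliable_partialStandardL_two : multipliable_partialStandardL (n := 2) (K := K) (μ := μ) :=
  multipliable_partialStandardL_of_schurSelfSum_prod_bounded jacquetShalika1981_schurSelfSum_prod_bounded_two

/-- The splitting `L(s, Π) = L^S(s, Π) · ∏_{v ∈ S} …` for cuspidal `Π` of `GL₂(𝔸_K)`
(`StandardLFunctionData.L_eq_partialStandardL_mul` for `n = 2`). [folklore] -/
theorem StandardLFunctionData.L_eq_partialStandardL_mul_two {P : CuspidalAutomorphicRepGL 2 K μ} :
    StandardLFunctionData.L_eq_partialStandardL_mul (P := P) :=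
  StandardLFunctionData.L_eq_partialStandardL_mul_of_schurSelfSum_prod_bounded jacquetShalika1981_schurSelfSum_prod_bounded_two

end Main

end Literature.NumberTheory.Automorphic
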